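import Summits.CriticalPhenomena.PercolationContinuityZ3.Theorems.PercNearOneGluingNoHeavyQuantLSCoreMMGIneqA
import Summits.CriticalPhenomena.PercolationContinuityZ3.Theorems.PercNearOneGluingNoHeavyQuantLSCoreLMGIneqA
import Summits.CriticalPhenomena.PercolationContinuityZ3.Theorems.PercNearOneGluingNoHeavyQuantLSCoreLMGIneqB
import Summits.CriticalPhenomena.PercolationContinuityZ3.Theorems.PercNearOneGluingNoHeavyQuantLSCoreLMGIneqC
import Summits.CriticalPhenomena.PercolationContinuityZ3.Theorems.PercNearOneGluingNoHeavyQuantLSCoreLMGIneqD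
import Summits.CriticalPhenomena.PercolationContinuityZ3.Theorems.PercNearOneGluingNoHeavyQuantLSCoreLMGIneqE
import Summits.CriticalPhenomena.PercolationContinuityZ3.Theorems.PercNearOneGluingNoHeavyQuantLSCoreLMGIneqF
import Summits.CriticalPhenomena.PercolationContinuityZ3.Theorems.PercNearOneGluingNoHeavyQuantLSCoreLMGIneqM
import Summits.CriticalPhenomena.PercolationContinuityZ3.Theorems.PercNearOneGluingNoHeavyQuantLSCoreLMGIneqN
import Summits.CriticalPhenomena.PercolationContinuityZ3.Theorems.PercNearOneGluingNoHeavyQuantLSCoreLMGIneqO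
import Summits.CriticalPhenomena.PercolationContinuityZ3.Theorems.PercNearOneGluingNoHeavyQuantLSCoreLMGCellsK
import Summits.CriticalPhenomena.PercolationContinuityZ3.Theorems.PercNearOneGluingNoHeavyQuantLSCoreLMGCellsL
import Mathlib.Tactic.Linarith
import Mathlib.Tactic.FieldSimp
import Mathlib.Tactic.Ring
import HarnessLib

/-!
# QUANT lane R8, T-DEC, binder (II) `ConvClosedTResidue`: LS-CORE, pattern LMG — the breakpoint inequalities of the two-low greedy after
# pre-routing the row-`m` low `m+l` into the head cell, by case analysis over the letters of the cross pairs (kB)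

builds on p205010 (kernel theorem, internal audit signed; external expert review pending)

Support file (`--supports stmt-CriticalPhenomena-4575`), QUANT lane seat prim-quant-census-1 (gen 22), rung R8 of
`run/shared/lean/prim/quant/LADDER.md`.  Theorems only, standard axioms, no sorries.  Memo `…/prim-quant-census-1/LSCORE-G22.md` §9–§10.

Scale-free coordinates of `…QuantLSCoreMMGIneqA` (`x, r, t, d, w`); efficiencies `e2P, e22` (low `p+l′` into `p+h`, `m+l′`), `e3` (the
pre-routed low `m+l` into `p+h`, deficit `r+d+2t−2w`, span `1+t−w`), the head-cell exchange ratio `κ`, and the residual head-cell capacity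
`cPres` / residual pool `poolres` after pre-routing (fits: `cPres = c_P − d₁/e3`, `poolres = pool`; saturates: `cPres = 0`,
`poolres = pool − d₁ + c_P·e3`), all given by conditional closed forms.  The lemmas are the hypotheses `hkG`, `hkB` (and the facts used for
`hkA`) of `LawDec.twoLow_greedy_flows` for pattern LMG; every leaf is one cell of `…QuantLSCoreLMGIneq*`.

[this work].  The gluing rows served [cite: KozmaNitzan2024, Conjecture 3 (p. 15)]; product measure [cite: Grimmett1999, §1.3 p. 10].
-/

namespace Summit.CriticalPhenomena.PercolationContinuityZ3.Theorems

namespace Quant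

namespace LawDec

namespace LSCoreLMG

set_option maxHeartbeats 8000000 in
/-- `kB` for pattern LMG, pre-routing pair heavy, first pair available, head pair light (one branch of the case tree of `kB_LMG`). [this work] -/
theorem kB_LMG_H1L (x r t d w e2P e22 e3 κP cPres poolres : ℝ) (hx0 : 0 < x) (hx1 : x < 1) (hr0 : 0 ≤ r) (hrx : r < x) (ht : 0 < t) (hw0 : 0 < w) (hw1 : w ≤ 1)
    (hd0 : 0 ≤ d) (hdx : d < x * w) (hre : 0 < r - x + t * (2 - x)) (hre1 : 0 < 1 - t - r)
    (hM1 : 2 * w < r + d + 2 * t) (hM2 : r + d ≤ 2 * w)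
    (_h2P_N : 1 ≤ (r + d) → e2P = 0)
    (_h2P_H : x ≤ (r + d) → (r + d) < 1 → e2P = (1 / (r + d) - 1))
    (h2P_L : (r + d) < x → e2P = (1 / ((1 - x) * (r + d) + x ^ (2:ℕ)) - 1))
    (h22_N : w ≤ (r + d) → e22 = 0)
    (h22_H : x * w ≤ (r + d) → (r + d) < w → e22 = (w / (r + d) - 1))
    (h22_L : (r + d) < x * w → e22 = (w / ((1 - x) * (r + d) + x ^ (2:ℕ) * w) - 1))
    (h3_H : x * (1 + t - w) ≤ (r + d + 2 * t - 2 * w) → e3 = (((1 + t - w) - (r + d + 2 * t - 2 * w)) / (r + d + 2 * t - 2 * w)))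
    (_h3_L : (r + d + 2 * t - 2 * w) < x * (1 + t - w) → e3 = (((1 + t - w) - ((1 - x) * (r + d + 2 * t - 2 * w) + x ^ (2:ℕ) * (1 + t - w))) / ((1 - x) * (r + d + 2 * t - 2 * w) + x ^ (2:ℕ) * (1 + t - w))))
    (_hκ_N : 1 + t ≤ (r + d + 2 * t) → κP = 0) (_hκ_H : (r + d + 2 * t) < 1 + t → x ≤ (r + d) → (r + d) < 1 → κP = (((1 + t) - (r + d + 2 * t)) * (r + d) / ((r + d + 2 * t) * (1 - (r + d))))) (hκ_L : (r + d + 2 * t) < 1 + t → (r + d) < x → κP = (((1 + t) - (r + d + 2 * t)) * ((1 - x) * (r + d) + x ^ (2:ℕ)) / ((r + d + 2 * t) * (1 - ((1 - x) * (r + d) + x ^ (2:ℕ))))))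
    (_hkA : ((x ^ (2:ℕ) + (1 - x) * d / w) * (1 - x) * ((1 + x - r) * (r - x + t * (2 - x)) / (t * (2 - x ^ (2:ℕ) - (1 - x) * r) - x * (x - r)))) * e22 ≤ ((1 - (x ^ (2:ℕ) + (1 - x) * d / w)) * (1 - x) * ((1 + x - r) * (r - x + t * (2 - x)) / (t * (2 - x ^ (2:ℕ) - (1 - x) * r) - x * (x - r)))))
    (hcase_f : ((x ^ (2:ℕ) + (1 - x) * d / w) * (1 - x) * ((x - r) * (1 - t - r) / (t * (2 - x ^ (2:ℕ) - (1 - x) * r) - x * (x - r)))) ≤ ((1 - (x ^ (2:ℕ) + (1 - x) * d / w)) * x) * e3 → cPres = ((1 - (x ^ (2:ℕ) + (1 - x) * d / w)) * x) - ((x ^ (2:ℕ) + (1 - x) * d / w) * (1 - x) * ((x - r) * (1 - t - r) / (t * (2 - x ^ (2:ℕ) - (1 - x) * r) - x * (x - r)))) / e3 ∧ poolres = ((x ^ (2:ℕ) + (1 - x) * d / w) * (1 - x)))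
    (_hcase_s : ((1 - (x ^ (2:ℕ) + (1 - x) * d / w)) * x) * e3 < ((x ^ (2:ℕ) + (1 - x) * d / w) * (1 - x) * ((x - r) * (1 - t - r) / (t * (2 - x ^ (2:ℕ) - (1 - x) * r) - x * (x - r)))) → cPres = 0 ∧ poolres = (((x ^ (2:ℕ) + (1 - x) * d / w) * (1 - x)) - ((x ^ (2:ℕ) + (1 - x) * d / w) * (1 - x) * ((x - r) * (1 - t - r) / (t * (2 - x ^ (2:ℕ) - (1 - x) * r) - x * (x - r)))) + ((1 - (x ^ (2:ℕ) + (1 - x) * d / w)) * x) * e3))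
    (_hav : (r + d) < 1) (hf : ((x ^ (2:ℕ) + (1 - x) * d / w) * (1 - x) * ((x - r) * (1 - t - r) / (t * (2 - x ^ (2:ℕ) - (1 - x) * r) - x * (x - r)))) ≤ ((1 - (x ^ (2:ℕ) + (1 - x) * d / w)) * x) * e3) (hpre : ((1 - (x ^ (2:ℕ) + (1 - x) * d / w)) * (1 - x) * ((1 + x - r) * (r - x + t * (2 - x)) / (t * (2 - x ^ (2:ℕ) - (1 - x) * r) - x * (x - r)))) ≤ ((x ^ (2:ℕ) + (1 - x) * d / w) * (1 - x) * ((1 + x - r) * (r - x + t * (2 - x)) / (t * (2 - x ^ (2:ℕ) - (1 - x) * r) - x * (x - r)))) * e22 + cPres * e2P)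
    (hk3 : x * (1 + t - w) ≤ (r + d + 2 * t - 2 * w)) (h1P : (r + d + 2 * t) < 1 + t) (h2L : (r + d) < x) :
    ((1 - (x ^ (2:ℕ) + (1 - x) * d / w)) * (1 - x) * ((x - r) * (1 - t - r) / (t * (2 - x ^ (2:ℕ) - (1 - x) * r) - x * (x - r)))) ≤ (((x ^ (2:ℕ) + (1 - x) * d / w) * (1 - x) * ((1 + x - r) * (r - x + t * (2 - x)) / (t * (2 - x ^ (2:ℕ) - (1 - x) * r) - x * (x - r)))) * e22 + cPres * e2P - ((1 - (x ^ (2:ℕ) + (1 - x) * d / w)) * (1 - x) * ((1 + x - r) * (r - x + t * (2 - x)) / (t * (2 - x ^ (2:ℕ) - (1 - x) * r) - x * (x - r))))) * κP + poolres := by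
  have hD : 0 < t * (2 - x ^ (2:ℕ) - (1 - x) * r) - x * (x - r) := LSCoreMMG.D_pos x r t hx0 hx1 hr0 hrx hre
  have hxw : x * w ≤ x := by nlinarith
  have hxw1 : x * w ≤ w := by nlinarith
  have hb3c : r + d + 2 * t - 2 * w < 1 + t - w := by nlinarith
  have hg0 : 0 ≤ (x ^ (2:ℕ) + (1 - x) * d / w) := by positivity
  have hlaml : 0 ≤ ((1 + x - r) * (r - x + t * (2 - x)) / (t * (2 - x ^ (2:ℕ) - (1 - x) * r) - x * (x - r))) := div_nonneg (mul_nonneg (by linarith) hre.le) hD.le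
  have hcM2 : 0 ≤ ((x ^ (2:ℕ) + (1 - x) * d / w) * (1 - x) * ((1 + x - r) * (r - x + t * (2 - x)) / (t * (2 - x ^ (2:ℕ) - (1 - x) * r) - x * (x - r)))) := mul_nonneg (mul_nonneg hg0 (by linarith)) hlaml
  have hlam : 0 ≤ ((x - r) * (1 - t - r) / (t * (2 - x ^ (2:ℕ) - (1 - x) * r) - x * (x - r))) := div_nonneg (mul_nonneg (by linarith) (by linarith)) hD.le
  have hcM1 : 0 ≤ ((x ^ (2:ℕ) + (1 - x) * d / w) * (1 - x) * ((x - r) * (1 - t - r) / (t * (2 - x ^ (2:ℕ) - (1 - x) * r) - x * (x - r)))) := mul_nonneg (mul_nonneg hg0 (by linarith)) hlam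
  obtain ⟨hcP, hpl⟩ := hcase_f hf
  rw [hcP] at hpre ⊢
  rw [hpl]
  clear hcase_f _hcase_s
  rw [h3_H hk3] at hf hpre ⊢
  -- light head pair: common gate `G2P` for the mid `m+l′` (one weakened cell for every letter of it)
  have hG : 0 < ((1 - x) * (r + d) + x ^ (2:ℕ)) := by positivity
  have hGx : ((1 - x) * (r + d) + x ^ (2:ℕ)) < 1 := by nlinarith
  have hBp : 0 < (r + d + 2 * t) := by linarith
  rw [h2P_L h2L] at hpre ⊢
  rw [hκ_L h1P h2L]
  have hκ0 : 0 ≤ ((1 + t) - (r + d + 2 * t)) * ((1 - x) * (r + d) + x ^ (2:ℕ)) / ((r + d + 2 * t) * (1 - ((1 - x) * (r + d) + x ^ (2:ℕ)))) :=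
    div_nonneg (mul_nonneg (by linarith) hG.le) (mul_nonneg hBp.le (by linarith))
  rcases le_or_gt (((1 - (x ^ (2:ℕ) + (1 - x) * d / w)) * (1 - x) * ((x - r) * (1 - t - r) / (t * (2 - x ^ (2:ℕ) - (1 - x) * r) - x * (x - r))))) (((x ^ (2:ℕ) + (1 - x) * d / w) * (1 - x))) with hQ | hQ
  · have hprod := mul_nonneg (sub_nonneg.2 hpre) hκ0
    linarith [hprod, hQ]
  · have h22w : w / ((1 - x) * (r + d) + x ^ (2:ℕ)) - 1 ≤ e22 := by
      rcases lt_or_ge ((r + d)) (x * w) with h1 | h1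
      · rw [h22_L h1]
        have hG2 : 0 < ((1 - x) * (r + d) + x ^ (2:ℕ) * w) := by positivity
        have : w / ((1 - x) * (r + d) + x ^ (2:ℕ)) ≤ w / ((1 - x) * (r + d) + x ^ (2:ℕ) * w) := div_le_div_of_nonneg_left hw0.le hG2 (by nlinarith)
        linarith
      · rcases lt_or_ge ((r + d)) w with h2 | h2
        · rw [h22_H h1 h2]
          have hA : 0 < (r + d) := by nlinarith [mul_pos hx0 hw0]
          have : w / ((1 - x) * (r + d) + x ^ (2:ℕ)) ≤ w / (r + d) := div_le_div_of_nonneg_left hw0.le hA (by nlinarith)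
          linarith
        · rw [h22_N h2]
          rw [sub_nonpos, div_le_one hG]; nlinarith
    have hc := ineq_kBw_3PHf_LHQp x r t d w hx0 hx1 hr0 hrx ht hw0 hw1 hd0 hdx hre hre1 hM1 hM2 hk3 hb3c hf h2L h1P hQ
    have hmono : (((x ^ (2:ℕ) + (1 - x) * d / w) * (1 - x) * ((1 + x - r) * (r - x + t * (2 - x)) / (t * (2 - x ^ (2:ℕ) - (1 - x) * r) - x * (x - r)))) * (w / ((1 - x) * (r + d) + x ^ (2:ℕ)) - 1) + (((1 - (x ^ (2:ℕ) + (1 - x) * d / w)) * x) - ((x ^ (2:ℕ) + (1 - x) * d / w) * (1 - x) * ((x - r) * (1 - t - r) / (t * (2 - x ^ (2:ℕ) - (1 - x) * r) - x * (x - r)))) / (((1 + t - w) - (r + d + 2 * t - 2 * w)) / (r + d + 2 * t - 2 * w))) * (1 / ((1 - x) * (r + d) + x ^ (2:ℕ)) - 1) - ((1 - (x ^ (2:ℕ) + (1 - x) * d / w)) * (1 - x) * ((1 + x - r) * (r - x + t * (2 - x)) / (t * (2 - x ^ (2:ℕ) - (1 - x) * r) - x * (x - r))))) * (((1 + t) -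 (r + d + 2 * t)) * ((1 - x) * (r + d) + x ^ (2:ℕ)) / ((r + d + 2 * t) * (1 - ((1 - x) * (r + d) + x ^ (2:ℕ)))))
        ≤ (((x ^ (2:ℕ) + (1 - x) * d / w) * (1 - x) * ((1 + x - r) * (r - x + t * (2 - x)) / (t * (2 - x ^ (2:ℕ) - (1 - x) * r) - x * (x - r)))) * e22 + (((1 - (x ^ (2:ℕ) + (1 - x) * d / w)) * x) - ((x ^ (2:ℕ) + (1 - x) * d / w) * (1 - x) * ((x - r) * (1 - t - r) / (t * (2 - x ^ (2:ℕ) - (1 - x) * r) - x * (x - r)))) / (((1 + t - w) - (r + d + 2 * t - 2 * w)) / (r + d + 2 * t - 2 * w))) * (1 / ((1 - x) * (r + d) + x ^ (2:ℕ)) - 1) - ((1 - (x ^ (2:ℕ) + (1 - x) * d / w)) * (1 - x) * ((1 + x - r) * (r - x + t * (2 - x)) / (t * (2 - x ^ (2:ℕ) - (1 - x) * r) - x * (x - r))))) * (((1 + t) - (r + d + 2 * t)) * ((1 - x) * (r + d) + x ^ (2:ℕ)) / ((r + d + 2 * t) * (1 - ((1 - x) * (r + d) + x ^ (2:ℕ)))))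 := by
      apply mul_le_mul_of_nonneg_right _ hκ0
      nlinarith [mul_le_mul_of_nonneg_left h22w hcM2]
    set ee : ℝ := (((1 + t - w) - (r + d + 2 * t - 2 * w)) / (r + d + 2 * t - 2 * w)) with hee
    set Lm : ℝ := ((x - r) * (1 - t - r) / (t * (2 - x ^ (2:ℕ) - (1 - x) * r) - x * (x - r))) with hLm
    set Lp : ℝ := ((1 + x - r) * (r - x + t * (2 - x)) / (t * (2 - x ^ (2:ℕ) - (1 - x) * r) - x * (x - r))) with hLp
    set gg : ℝ := (x ^ (2:ℕ) + (1 - x) * d / w) with hgg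
    clear_value ee Lm Lp gg
    linarith
set_option maxHeartbeats 8000000 in
/-- `kB` for pattern LMG, pre-routing pair heavy, first pair available, head pair heavy (one branch of the case tree of `kB_LMG`). [this work] -/
theorem kB_LMG_H1H (x r t d w e2P e22 e3 κP cPres poolres : ℝ) (hx0 : 0 < x) (hx1 : x < 1) (hr0 : 0 ≤ r) (hrx : r < x) (ht : 0 < t) (hw0 : 0 < w) (hw1 : w ≤ 1)
    (hd0 : 0 ≤ d) (hdx : d < x * w) (hre : 0 < r - x + t * (2 - x)) (hre1 : 0 < 1 - t - r)
    (_hM1 : 2 * w < r + d + 2 * t) (_hM2 : r + d ≤ 2 * w)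
    (_h2P_N : 1 ≤ (r + d) → e2P = 0)
    (h2P_H : x ≤ (r + d) → (r + d) < 1 → e2P = (1 / (r + d) - 1))
    (_h2P_L : (r + d) < x → e2P = (1 / ((1 - x) * (r + d) + x ^ (2:ℕ)) - 1))
    (_h22_N : w ≤ (r + d) → e22 = 0)
    (_h22_H : x * w ≤ (r + d) → (r + d) < w → e22 = (w / (r + d) - 1))
    (_h22_L : (r + d) < x * w → e22 = (w / ((1 - x) * (r + d) + x ^ (2:ℕ) * w) - 1))
    (h3_H : x * (1 + t - w) ≤ (r + d + 2 * t - 2 * w) → e3 = (((1 + t - w) - (r + d + 2 * t - 2 * w)) / (r + d + 2 * t - 2 * w)))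
    (_h3_L : (r + d + 2 * t - 2 * w) < x * (1 + t - w) → e3 = (((1 + t - w) - ((1 - x) * (r + d + 2 * t - 2 * w) + x ^ (2:ℕ) * (1 + t - w))) / ((1 - x) * (r + d + 2 * t - 2 * w) + x ^ (2:ℕ) * (1 + t - w))))
    (_hκ_N : 1 + t ≤ (r + d + 2 * t) → κP = 0) (hκ_H : (r + d + 2 * t) < 1 + t → x ≤ (r + d) → (r + d) < 1 → κP = (((1 + t) - (r + d + 2 * t)) * (r + d) / ((r + d + 2 * t) * (1 - (r + d))))) (_hκ_L : (r + d + 2 * t) < 1 + t → (r + d) < x → κP = (((1 + t) - (r + d + 2 * t)) * ((1 - x) * (r + d) + x ^ (2:ℕ)) / ((r + d + 2 * t) * (1 - ((1 - x) * (r + d) + x ^ (2:ℕ))))))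
    (_hkA : ((x ^ (2:ℕ) + (1 - x) * d / w) * (1 - x) * ((1 + x - r) * (r - x + t * (2 - x)) / (t * (2 - x ^ (2:ℕ) - (1 - x) * r) - x * (x - r)))) * e22 ≤ ((1 - (x ^ (2:ℕ) + (1 - x) * d / w)) * (1 - x) * ((1 + x - r) * (r - x + t * (2 - x)) / (t * (2 - x ^ (2:ℕ) - (1 - x) * r) - x * (x - r)))))
    (hcase_f : ((x ^ (2:ℕ) + (1 - x) * d / w) * (1 - x) * ((x - r) * (1 - t - r) / (t * (2 - x ^ (2:ℕ) - (1 - x) * r) - x * (x - r)))) ≤ ((1 - (x ^ (2:ℕ) + (1 - x) * d / w)) * x) * e3 → cPres = ((1 - (x ^ (2:ℕ) + (1 - x) * d / w)) * x) - ((x ^ (2:ℕ) + (1 - x) * d / w) * (1 - x) * ((x - r) * (1 - t - r) / (t * (2 - x ^ (2:ℕ) - (1 - x) * r) - x * (x - r)))) / e3 ∧ poolres = ((x ^ (2:ℕ) + (1 - x) * d / w) * (1 - x)))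
    (_hcase_s : ((1 - (x ^ (2:ℕ) + (1 - x) * d / w)) * x) * e3 < ((x ^ (2:ℕ) + (1 - x) * d / w) * (1 - x) * ((x - r) * (1 - t - r) / (t * (2 - x ^ (2:ℕ) - (1 - x) * r) - x * (x - r)))) → cPres = 0 ∧ poolres = (((x ^ (2:ℕ) + (1 - x) * d / w) * (1 - x)) - ((x ^ (2:ℕ) + (1 - x) * d / w) * (1 - x) * ((x - r) * (1 - t - r) / (t * (2 - x ^ (2:ℕ) - (1 - x) * r) - x * (x - r)))) + ((1 - (x ^ (2:ℕ) + (1 - x) * d / w)) * x) * e3))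
    (hav : (r + d) < 1) (hf : ((x ^ (2:ℕ) + (1 - x) * d / w) * (1 - x) * ((x - r) * (1 - t - r) / (t * (2 - x ^ (2:ℕ) - (1 - x) * r) - x * (x - r)))) ≤ ((1 - (x ^ (2:ℕ) + (1 - x) * d / w)) * x) * e3) (hpre : ((1 - (x ^ (2:ℕ) + (1 - x) * d / w)) * (1 - x) * ((1 + x - r) * (r - x + t * (2 - x)) / (t * (2 - x ^ (2:ℕ) - (1 - x) * r) - x * (x - r)))) ≤ ((x ^ (2:ℕ) + (1 - x) * d / w) * (1 - x) * ((1 + x - r) * (r - x + t * (2 - x)) / (t * (2 - x ^ (2:ℕ) - (1 - x) * r) - x * (x - r)))) * e22 + cPres * e2P)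
    (hk3 : x * (1 + t - w) ≤ (r + d + 2 * t - 2 * w)) (h1P : (r + d + 2 * t) < 1 + t) (h2H : x ≤ (r + d)) :
    ((1 - (x ^ (2:ℕ) + (1 - x) * d / w)) * (1 - x) * ((x - r) * (1 - t - r) / (t * (2 - x ^ (2:ℕ) - (1 - x) * r) - x * (x - r)))) ≤ (((x ^ (2:ℕ) + (1 - x) * d / w) * (1 - x) * ((1 + x - r) * (r - x + t * (2 - x)) / (t * (2 - x ^ (2:ℕ) - (1 - x) * r) - x * (x - r)))) * e22 + cPres * e2P - ((1 - (x ^ (2:ℕ) + (1 - x) * d / w)) * (1 - x) * ((1 + x - r) * (r - x + t * (2 - x)) / (t * (2 - x ^ (2:ℕ) - (1 - x) * r) - x * (x - r))))) * κP + poolres := by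
  have hD : 0 < t * (2 - x ^ (2:ℕ) - (1 - x) * r) - x * (x - r) := LSCoreMMG.D_pos x r t hx0 hx1 hr0 hrx hre
  have hxw : x * w ≤ x := by nlinarith
  have hxw1 : x * w ≤ w := by nlinarith
  have hb3c : r + d + 2 * t - 2 * w < 1 + t - w := by nlinarith
  have hg0 : 0 ≤ (x ^ (2:ℕ) + (1 - x) * d / w) := by positivity
  have hlaml : 0 ≤ ((1 + x - r) * (r - x + t * (2 - x)) / (t * (2 - x ^ (2:ℕ) - (1 - x) * r) - x * (x - r))) := div_nonneg (mul_nonneg (by linarith) hre.le) hD.le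
  have hcM2 : 0 ≤ ((x ^ (2:ℕ) + (1 - x) * d / w) * (1 - x) * ((1 + x - r) * (r - x + t * (2 - x)) / (t * (2 - x ^ (2:ℕ) - (1 - x) * r) - x * (x - r)))) := mul_nonneg (mul_nonneg hg0 (by linarith)) hlaml
  have hlam : 0 ≤ ((x - r) * (1 - t - r) / (t * (2 - x ^ (2:ℕ) - (1 - x) * r) - x * (x - r))) := div_nonneg (mul_nonneg (by linarith) (by linarith)) hD.le
  have hcM1 : 0 ≤ ((x ^ (2:ℕ) + (1 - x) * d / w) * (1 - x) * ((x - r) * (1 - t - r) / (t * (2 - x ^ (2:ℕ) - (1 - x) * r) - x * (x - r)))) := mul_nonneg (mul_nonneg hg0 (by linarith)) hlam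
  obtain ⟨hcP, hpl⟩ := hcase_f hf
  rw [hcP] at hpre ⊢
  rw [hpl]
  clear hcase_f _hcase_s
  rw [h3_H hk3] at hf hpre ⊢
  rw [h2P_H h2H hav] at hpre ⊢
  rw [hκ_H h1P h2H hav]
  have hBp : 0 < (r + d + 2 * t) := by linarith
  have hκ0 : 0 ≤ ((1 + t) - (r + d + 2 * t)) * (r + d) / ((r + d + 2 * t) * (1 - (r + d))) := div_nonneg (mul_nonneg (by linarith) (by linarith)) (mul_nonneg hBp.le (by linarith))
  have hQ := P1_le_pool_2PH_3PH x r t d w hx0 hx1 hr0 hrx ht hw0 hw1 hd0 hdx hre hre1 h2H hk3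
  have hprod := mul_nonneg (sub_nonneg.2 hpre) hκ0
  linarith [hprod, hQ]

set_option maxHeartbeats 8000000 in
/-- `kB` for pattern LMG, pre-routing pair heavy, first pair unavailable (one branch of the case tree of `kB_LMG`). [this work] -/
theorem kB_LMG_H0 (x r t d w e2P e22 e3 κP cPres poolres : ℝ) (hx0 : 0 < x) (hx1 : x < 1) (hr0 : 0 ≤ r) (hrx : r < x) (ht : 0 < t) (hw0 : 0 < w) (hw1 : w ≤ 1)
    (hd0 : 0 ≤ d) (hdx : d < x * w) (hre : 0 < r - x + t * (2 - x)) (hre1 : 0 < 1 - t - r)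
    (hM1 : 2 * w < r + d + 2 * t) (hM2 : r + d ≤ 2 * w)
    (_h2P_N : 1 ≤ (r + d) → e2P = 0)
    (h2P_H : x ≤ (r + d) → (r + d) < 1 → e2P = (1 / (r + d) - 1))
    (h2P_L : (r + d) < x → e2P = (1 / ((1 - x) * (r + d) + x ^ (2:ℕ)) - 1))
    (h22_N : w ≤ (r + d) → e22 = 0)
    (h22_H : x * w ≤ (r + d) → (r + d) < w → e22 = (w / (r + d) - 1))
    (h22_L : (r + d) < x * w → e22 = (w / ((1 - x) * (r + d) + x ^ (2:ℕ) * w) - 1))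
    (h3_H : x * (1 + t - w) ≤ (r + d + 2 * t - 2 * w) → e3 = (((1 + t - w) - (r + d + 2 * t - 2 * w)) / (r + d + 2 * t - 2 * w)))
    (_h3_L : (r + d + 2 * t - 2 * w) < x * (1 + t - w) → e3 = (((1 + t - w) - ((1 - x) * (r + d + 2 * t - 2 * w) + x ^ (2:ℕ) * (1 + t - w))) / ((1 - x) * (r + d + 2 * t - 2 * w) + x ^ (2:ℕ) * (1 + t - w))))
    (hκ_N : 1 + t ≤ (r + d + 2 * t) → κP = 0) (_hκ_H : (r + d + 2 * t) < 1 + t → x ≤ (r + d) → (r + d) < 1 → κP = (((1 + t) - (r + d + 2 * t)) * (r + d) / ((r + d + 2 * t) * (1 - (r + d))))) (_hκ_L : (r + d + 2 * t) < 1 + t → (r + d) < x → κP = (((1 + t) - (r + d + 2 * t)) * ((1 - x) * (r + d) + x ^ (2:ℕ)) / ((r + d + 2 * t) * (1 - ((1 - x) * (r + d) + x ^ (2:ℕ))))))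
    (_hkA : ((x ^ (2:ℕ) + (1 - x) * d / w) * (1 - x) * ((1 + x - r) * (r - x + t * (2 - x)) / (t * (2 - x ^ (2:ℕ) - (1 - x) * r) - x * (x - r)))) * e22 ≤ ((1 - (x ^ (2:ℕ) + (1 - x) * d / w)) * (1 - x) * ((1 + x - r) * (r - x + t * (2 - x)) / (t * (2 - x ^ (2:ℕ) - (1 - x) * r) - x * (x - r)))))
    (hcase_f : ((x ^ (2:ℕ) + (1 - x) * d / w) * (1 - x) * ((x - r) * (1 - t - r) / (t * (2 - x ^ (2:ℕ) - (1 - x) * r) - x * (x - r)))) ≤ ((1 - (x ^ (2:ℕ) + (1 - x) * d / w)) * x) * e3 → cPres = ((1 - (x ^ (2:ℕ) + (1 - x) * d / w)) * x) - ((x ^ (2:ℕ) + (1 - x) * d / w) * (1 - x) * ((x - r) * (1 - t - r) / (t * (2 - x ^ (2:ℕ) - (1 - x) * r) - x * (x - r)))) / e3 ∧ poolres = ((x ^ (2:ℕ) + (1 - x) * d / w) * (1 - x)))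
    (_hcase_s : ((1 - (x ^ (2:ℕ) + (1 - x) * d / w)) * x) * e3 < ((x ^ (2:ℕ) + (1 - x) * d / w) * (1 - x) * ((x - r) * (1 - t - r) / (t * (2 - x ^ (2:ℕ) - (1 - x) * r) - x * (x - r)))) → cPres = 0 ∧ poolres = (((x ^ (2:ℕ) + (1 - x) * d / w) * (1 - x)) - ((x ^ (2:ℕ) + (1 - x) * d / w) * (1 - x) * ((x - r) * (1 - t - r) / (t * (2 - x ^ (2:ℕ) - (1 - x) * r) - x * (x - r)))) + ((1 - (x ^ (2:ℕ) + (1 - x) * d / w)) * x) * e3))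
    (hav : (r + d) < 1) (hf : ((x ^ (2:ℕ) + (1 - x) * d / w) * (1 - x) * ((x - r) * (1 - t - r) / (t * (2 - x ^ (2:ℕ) - (1 - x) * r) - x * (x - r)))) ≤ ((1 - (x ^ (2:ℕ) + (1 - x) * d / w)) * x) * e3) (hpre : ((1 - (x ^ (2:ℕ) + (1 - x) * d / w)) * (1 - x) * ((1 + x - r) * (r - x + t * (2 - x)) / (t * (2 - x ^ (2:ℕ) - (1 - x) * r) - x * (x - r)))) ≤ ((x ^ (2:ℕ) + (1 - x) * d / w) * (1 - x) * ((1 + x - r) * (r - x + t * (2 - x)) / (t * (2 - x ^ (2:ℕ) - (1 - x) * r) - x * (x - r)))) * e22 + cPres * e2P)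
    (hk3 : x * (1 + t - w) ≤ (r + d + 2 * t - 2 * w)) (h1Pn : 1 + t ≤ (r + d + 2 * t))  :
    ((1 - (x ^ (2:ℕ) + (1 - x) * d / w)) * (1 - x) * ((x - r) * (1 - t - r) / (t * (2 - x ^ (2:ℕ) - (1 - x) * r) - x * (x - r)))) ≤ (((x ^ (2:ℕ) + (1 - x) * d / w) * (1 - x) * ((1 + x - r) * (r - x + t * (2 - x)) / (t * (2 - x ^ (2:ℕ) - (1 - x) * r) - x * (x - r)))) * e22 + cPres * e2P - ((1 - (x ^ (2:ℕ) + (1 - x) * d / w)) * (1 - x) * ((1 + x - r) * (r - x + t * (2 - x)) / (t * (2 - x ^ (2:ℕ) - (1 - x) * r) - x * (x - r))))) * κP + poolres := by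
  have hD : 0 < t * (2 - x ^ (2:ℕ) - (1 - x) * r) - x * (x - r) := LSCoreMMG.D_pos x r t hx0 hx1 hr0 hrx hre
  have hxw : x * w ≤ x := by nlinarith
  have hxw1 : x * w ≤ w := by nlinarith
  have hb3c : r + d + 2 * t - 2 * w < 1 + t - w := by nlinarith
  have hg0 : 0 ≤ (x ^ (2:ℕ) + (1 - x) * d / w) := by positivity
  have hlaml : 0 ≤ ((1 + x - r) * (r - x + t * (2 - x)) / (t * (2 - x ^ (2:ℕ) - (1 - x) * r) - x * (x - r))) := div_nonneg (mul_nonneg (by linarith) hre.le) hD.le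
  have hcM2 : 0 ≤ ((x ^ (2:ℕ) + (1 - x) * d / w) * (1 - x) * ((1 + x - r) * (r - x + t * (2 - x)) / (t * (2 - x ^ (2:ℕ) - (1 - x) * r) - x * (x - r)))) := mul_nonneg (mul_nonneg hg0 (by linarith)) hlaml
  have hlam : 0 ≤ ((x - r) * (1 - t - r) / (t * (2 - x ^ (2:ℕ) - (1 - x) * r) - x * (x - r))) := div_nonneg (mul_nonneg (by linarith) (by linarith)) hD.le
  have hcM1 : 0 ≤ ((x ^ (2:ℕ) + (1 - x) * d / w) * (1 - x) * ((x - r) * (1 - t - r) / (t * (2 - x ^ (2:ℕ) - (1 - x) * r) - x * (x - r)))) := mul_nonneg (mul_nonneg hg0 (by linarith)) hlam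
  obtain ⟨hcP, hpl⟩ := hcase_f hf
  rw [hcP] at hpre ⊢
  rw [hpl]
  clear hcase_f _hcase_s
  rw [h3_H hk3] at hf hpre ⊢
  rw [hκ_N h1Pn]
  rcases lt_or_ge ((r + d)) x with h2L | h2H
  · rw [h2P_L h2L] at hpre ⊢
    rcases lt_or_ge ((r + d)) (x * w) with h22L | h22a
    · rw [h22_L h22L] at hpre _hkA ⊢
      have hc := ineq_kB0_3PHf_L_L x r t d w hx0 hx1 hr0 hrx ht hw0 hw1 hd0 hdx hre hre1 hM1 hM2 hk3 hb3c hf h22L h2L h1Pn (by simpa only [zero_mul, mul_zero, add_zero, zero_add] using hpre)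
      set ee : ℝ := (((1 + t - w) - (r + d + 2 * t - 2 * w)) / (r + d + 2 * t - 2 * w)) with hee
      set Lm : ℝ := ((x - r) * (1 - t - r) / (t * (2 - x ^ (2:ℕ) - (1 - x) * r) - x * (x - r))) with hLm
      set Lp : ℝ := ((1 + x - r) * (r - x + t * (2 - x)) / (t * (2 - x ^ (2:ℕ) - (1 - x) * r) - x * (x - r))) with hLp
      set gg : ℝ := (x ^ (2:ℕ) + (1 - x) * d / w) with hgg
      clear_value ee Lm Lp gg
      nlinarith [hc]
    · rcases lt_or_ge ((r + d)) w with h22b | h22n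
      · rw [h22_H h22a h22b] at hpre _hkA ⊢
        have hc := ineq_kB0_3PHf_H_L x r t d w hx0 hx1 hr0 hrx ht hw0 hw1 hd0 hdx hre hre1 hM1 hM2 hk3 hb3c hf h22a h22b h2L h1Pn (by simpa only [zero_mul, mul_zero, add_zero, zero_add] using hpre)
        set ee : ℝ := (((1 + t - w) - (r + d + 2 * t - 2 * w)) / (r + d + 2 * t - 2 * w)) with hee
        set Lm : ℝ := ((x - r) * (1 - t - r) / (t * (2 - x ^ (2:ℕ) - (1 - x) * r) - x * (x - r))) with hLm
        set Lp : ℝ := ((1 + x - r) * (r - x + t * (2 - x)) / (t * (2 - x ^ (2:ℕ) - (1 - x) * r) - x * (x - r))) with hLp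
        set gg : ℝ := (x ^ (2:ℕ) + (1 - x) * d / w) with hgg
        clear_value ee Lm Lp gg
        nlinarith [hc]
      · rw [h22_N h22n] at hpre _hkA ⊢
        have hc := ineq_kB0_3PHf_N_L x r t d w hx0 hx1 hr0 hrx ht hw0 hw1 hd0 hdx hre hre1 hM1 hM2 hk3 hb3c hf h22n h2L h1Pn (by simpa only [zero_mul, mul_zero, add_zero, zero_add] using hpre)
        set ee : ℝ := (((1 + t - w) - (r + d + 2 * t - 2 * w)) / (r + d + 2 * t - 2 * w)) with hee
        set Lm : ℝ := ((x - r) * (1 - t - r) / (t * (2 - x ^ (2:ℕ) - (1 - x) * r) - x * (x - r))) with hLm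
        set Lp : ℝ := ((1 + x - r) * (r - x + t * (2 - x)) / (t * (2 - x ^ (2:ℕ) - (1 - x) * r) - x * (x - r))) with hLp
        set gg : ℝ := (x ^ (2:ℕ) + (1 - x) * d / w) with hgg
        clear_value ee Lm Lp gg
        nlinarith [hc]
  · rw [h2P_H h2H hav] at hpre ⊢
    rcases lt_or_ge ((r + d)) w with h22b | h22n
    · rw [h22_H (le_trans hxw h2H) h22b] at hpre _hkA ⊢
      have hc := ineq_kB0_3PHf_H_H x r t d w hx0 hx1 hr0 hrx ht hw0 hw1 hd0 hdx hre hre1 hM1 hM2 hk3 hb3c hf (le_trans hxw h2H) h22b h2H hav h1Pn (by simpa only [zero_mul, mul_zero, add_zero, zero_add] using hpre)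
      set ee : ℝ := (((1 + t - w) - (r + d + 2 * t - 2 * w)) / (r + d + 2 * t - 2 * w)) with hee
      set Lm : ℝ := ((x - r) * (1 - t - r) / (t * (2 - x ^ (2:ℕ) - (1 - x) * r) - x * (x - r))) with hLm
      set Lp : ℝ := ((1 + x - r) * (r - x + t * (2 - x)) / (t * (2 - x ^ (2:ℕ) - (1 - x) * r) - x * (x - r))) with hLp
      set gg : ℝ := (x ^ (2:ℕ) + (1 - x) * d / w) with hgg
      clear_value ee Lm Lp gg
      nlinarith [hc]
    · -- 22 unavailable & 2P heavy & 1P unavailable: A ≥ w and B ≥ 1+t; premise P₂ ≤ a₂(p+h)′ — cell kB0_3P?f_-_H (rare) or vacuous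
      rw [h22_N h22n] at hpre _hkA ⊢
      have hc := ineq_kB0_3PHf_N_H x r t d w hx0 hx1 hr0 hrx ht hw0 hw1 hd0 hdx hre hre1 hM1 hM2 hk3 hb3c hf h22n h2H hav h1Pn (by simpa only [zero_mul, mul_zero, add_zero, zero_add] using hpre)
      set ee : ℝ := (((1 + t - w) - (r + d + 2 * t - 2 * w)) / (r + d + 2 * t - 2 * w)) with hee
      set Lm : ℝ := ((x - r) * (1 - t - r) / (t * (2 - x ^ (2:ℕ) - (1 - x) * r) - x * (x - r))) with hLm
      set Lp : ℝ := ((1 + x - r) * (r - x + t * (2 - x)) / (t * (2 - x ^ (2:ℕ) - (1 - x) * r) - x * (x - r))) with hLp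
      set gg : ℝ := (x ^ (2:ℕ) + (1 - x) * d / w) with hgg
      clear_value ee Lm Lp gg
      nlinarith [hc]

set_option maxHeartbeats 8000000 in
/-- `kB` for pattern LMG, pre-routing pair heavy, first pair available. [this work] -/
theorem kB_LMG_H1 (x r t d w e2P e22 e3 κP cPres poolres : ℝ) (hx0 : 0 < x) (hx1 : x < 1) (hr0 : 0 ≤ r) (hrx : r < x) (ht : 0 < t) (hw0 : 0 < w) (hw1 : w ≤ 1)
    (hd0 : 0 ≤ d) (hdx : d < x * w) (hre : 0 < r - x + t * (2 - x)) (hre1 : 0 < 1 - t - r)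
    (hM1 : 2 * w < r + d + 2 * t) (hM2 : r + d ≤ 2 * w)
    (h2P_N : 1 ≤ (r + d) → e2P = 0)
    (h2P_H : x ≤ (r + d) → (r + d) < 1 → e2P = (1 / (r + d) - 1))
    (h2P_L : (r + d) < x → e2P = (1 / ((1 - x) * (r + d) + x ^ (2:ℕ)) - 1))
    (h22_N : w ≤ (r + d) → e22 = 0)
    (h22_H : x * w ≤ (r + d) → (r + d) < w → e22 = (w / (r + d) - 1))
    (h22_L : (r + d) < x * w → e22 = (w / ((1 - x) * (r + d) + x ^ (2:ℕ) * w) - 1))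
    (h3_H : x * (1 + t - w) ≤ (r + d + 2 * t - 2 * w) → e3 = (((1 + t - w) - (r + d + 2 * t - 2 * w)) / (r + d + 2 * t - 2 * w)))
    (h3_L : (r + d + 2 * t - 2 * w) < x * (1 + t - w) → e3 = (((1 + t - w) - ((1 - x) * (r + d + 2 * t - 2 * w) + x ^ (2:ℕ) * (1 + t - w))) / ((1 - x) * (r + d + 2 * t - 2 * w) + x ^ (2:ℕ) * (1 + t - w))))
    (hκ_N : 1 + t ≤ (r + d + 2 * t) → κP = 0) (hκ_H : (r + d + 2 * t) < 1 + t → x ≤ (r + d) → (r + d) < 1 → κP = (((1 + t) - (r + d + 2 * t)) * (r + d) / ((r + d + 2 * t) * (1 - (r + d))))) (hκ_L : (r + d + 2 * t) < 1 + t → (r + d) < x → κP = (((1 + t) - (r + d + 2 * t)) * ((1 - x) * (r + d) + x ^ (2:ℕ)) / ((r + d + 2 * t) * (1 - ((1 - x) * (r + d) + x ^ (2:ℕ))))))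
    (hkA : ((x ^ (2:ℕ) + (1 - x) * d / w) * (1 - x) * ((1 + x - r) * (r - x + t * (2 - x)) / (t * (2 - x ^ (2:ℕ) - (1 - x) * r) - x * (x - r)))) * e22 ≤ ((1 - (x ^ (2:ℕ) + (1 - x) * d / w)) * (1 - x) * ((1 + x - r) * (r - x + t * (2 - x)) / (t * (2 - x ^ (2:ℕ) - (1 - x) * r) - x * (x - r)))))
    (hcase_f : ((x ^ (2:ℕ) + (1 - x) * d / w) * (1 - x) * ((x - r) * (1 - t - r) / (t * (2 - x ^ (2:ℕ) - (1 - x) * r) - x * (x - r)))) ≤ ((1 - (x ^ (2:ℕ) + (1 - x) * d / w)) * x) * e3 → cPres = ((1 - (x ^ (2:ℕ) + (1 - x) * d / w)) * x) - ((x ^ (2:ℕ) + (1 - x) * d / w) * (1 - x) * ((x - r) * (1 - t - r) / (t * (2 - x ^ (2:ℕ) - (1 - x) * r) - x * (x - r)))) / e3 ∧ poolres = ((x ^ (2:ℕ) + (1 - x) * d / w) * (1 - x)))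
    (hcase_s : ((1 - (x ^ (2:ℕ) + (1 - x) * d / w)) * x) * e3 < ((x ^ (2:ℕ) + (1 - x) * d / w) * (1 - x) * ((x - r) * (1 - t - r) / (t * (2 - x ^ (2:ℕ) - (1 - x) * r) - x * (x - r)))) → cPres = 0 ∧ poolres = (((x ^ (2:ℕ) + (1 - x) * d / w) * (1 - x)) - ((x ^ (2:ℕ) + (1 - x) * d / w) * (1 - x) * ((x - r) * (1 - t - r) / (t * (2 - x ^ (2:ℕ) - (1 - x) * r) - x * (x - r)))) + ((1 - (x ^ (2:ℕ) + (1 - x) * d / w)) * x) * e3))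
    (hav : (r + d) < 1) (hf : ((x ^ (2:ℕ) + (1 - x) * d / w) * (1 - x) * ((x - r) * (1 - t - r) / (t * (2 - x ^ (2:ℕ) - (1 - x) * r) - x * (x - r)))) ≤ ((1 - (x ^ (2:ℕ) + (1 - x) * d / w)) * x) * e3) (hpre : ((1 - (x ^ (2:ℕ) + (1 - x) * d / w)) * (1 - x) * ((1 + x - r) * (r - x + t * (2 - x)) / (t * (2 - x ^ (2:ℕ) - (1 - x) * r) - x * (x - r)))) ≤ ((x ^ (2:ℕ) + (1 - x) * d / w) * (1 - x) * ((1 + x - r) * (r - x + t * (2 - x)) / (t * (2 - x ^ (2:ℕ) - (1 - x) * r) - x * (x - r)))) * e22 + cPres * e2P)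
    (hk3 : x * (1 + t - w) ≤ (r + d + 2 * t - 2 * w)) (h1P : (r + d + 2 * t) < 1 + t) :
    ((1 - (x ^ (2:ℕ) + (1 - x) * d / w)) * (1 - x) * ((x - r) * (1 - t - r) / (t * (2 - x ^ (2:ℕ) - (1 - x) * r) - x * (x - r)))) ≤ (((x ^ (2:ℕ) + (1 - x) * d / w) * (1 - x) * ((1 + x - r) * (r - x + t * (2 - x)) / (t * (2 - x ^ (2:ℕ) - (1 - x) * r) - x * (x - r)))) * e22 + cPres * e2P - ((1 - (x ^ (2:ℕ) + (1 - x) * d / w)) * (1 - x) * ((1 + x - r) * (r - x + t * (2 - x)) / (t * (2 - x ^ (2:ℕ) - (1 - x) * r) - x * (x - r))))) * κP + poolres := by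
  rcases lt_or_ge ((r + d)) x with h2L | h2H
  · exact kB_LMG_H1L x r t d w e2P e22 e3 κP cPres poolres hx0 hx1 hr0 hrx ht hw0 hw1 hd0 hdx hre hre1 hM1 hM2 h2P_N h2P_H h2P_L h22_N h22_H h22_L h3_H h3_L hκ_N hκ_H hκ_L hkA hcase_f hcase_s hav hf hpre hk3 h1P h2L
  · exact kB_LMG_H1H x r t d w e2P e22 e3 κP cPres poolres hx0 hx1 hr0 hrx ht hw0 hw1 hd0 hdx hre hre1 hM1 hM2 h2P_N h2P_H h2P_L h22_N h22_H h22_L h3_H h3_L hκ_N hκ_H hκ_L hkA hcase_f hcase_s hav hf hpre hk3 h1P h2H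
set_option maxHeartbeats 8000000 in
/-- `kB` for pattern LMG, pre-routing pair heavy (half of the case tree of `kB_LMG`). [this work] -/
theorem kB_LMG_H (x r t d w e2P e22 e3 κP cPres poolres : ℝ) (hx0 : 0 < x) (hx1 : x < 1) (hr0 : 0 ≤ r) (hrx : r < x) (ht : 0 < t) (hw0 : 0 < w) (hw1 : w ≤ 1)
    (hd0 : 0 ≤ d) (hdx : d < x * w) (hre : 0 < r - x + t * (2 - x)) (hre1 : 0 < 1 - t - r)
    (hM1 : 2 * w < r + d + 2 * t) (hM2 : r + d ≤ 2 * w)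
    (h2P_N : 1 ≤ (r + d) → e2P = 0)
    (h2P_H : x ≤ (r + d) → (r + d) < 1 → e2P = (1 / (r + d) - 1))
    (h2P_L : (r + d) < x → e2P = (1 / ((1 - x) * (r + d) + x ^ (2:ℕ)) - 1))
    (h22_N : w ≤ (r + d) → e22 = 0)
    (h22_H : x * w ≤ (r + d) → (r + d) < w → e22 = (w / (r + d) - 1))
    (h22_L : (r + d) < x * w → e22 = (w / ((1 - x) * (r + d) + x ^ (2:ℕ) * w) - 1))
    (h3_H : x * (1 + t - w) ≤ (r + d + 2 * t - 2 * w) → e3 = (((1 + t - w) - (r + d + 2 * t - 2 * w)) / (r + d + 2 * t - 2 * w)))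
    (h3_L : (r + d + 2 * t - 2 * w) < x * (1 + t - w) → e3 = (((1 + t - w) - ((1 - x) * (r + d + 2 * t - 2 * w) + x ^ (2:ℕ) * (1 + t - w))) / ((1 - x) * (r + d + 2 * t - 2 * w) + x ^ (2:ℕ) * (1 + t - w))))
    (hκ_N : 1 + t ≤ (r + d + 2 * t) → κP = 0) (hκ_H : (r + d + 2 * t) < 1 + t → x ≤ (r + d) → (r + d) < 1 → κP = (((1 + t) - (r + d + 2 * t)) * (r + d) / ((r + d + 2 * t) * (1 - (r + d))))) (hκ_L : (r + d + 2 * t) < 1 + t → (r + d) < x → κP = (((1 + t) - (r + d + 2 * t)) * ((1 - x) * (r + d) + x ^ (2:ℕ)) / ((r + d + 2 * t) * (1 - ((1 - x) * (r + d) + x ^ (2:ℕ))))))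
    (hkA : ((x ^ (2:ℕ) + (1 - x) * d / w) * (1 - x) * ((1 + x - r) * (r - x + t * (2 - x)) / (t * (2 - x ^ (2:ℕ) - (1 - x) * r) - x * (x - r)))) * e22 ≤ ((1 - (x ^ (2:ℕ) + (1 - x) * d / w)) * (1 - x) * ((1 + x - r) * (r - x + t * (2 - x)) / (t * (2 - x ^ (2:ℕ) - (1 - x) * r) - x * (x - r)))))
    (hcase_f : ((x ^ (2:ℕ) + (1 - x) * d / w) * (1 - x) * ((x - r) * (1 - t - r) / (t * (2 - x ^ (2:ℕ) - (1 - x) * r) - x * (x - r)))) ≤ ((1 - (x ^ (2:ℕ) + (1 - x) * d / w)) * x) * e3 → cPres = ((1 - (x ^ (2:ℕ) + (1 - x) * d / w)) * x) - ((x ^ (2:ℕ) + (1 - x) * d / w) * (1 - x) * ((x - r) * (1 - t - r) / (t * (2 - x ^ (2:ℕ) - (1 - x) * r) - x * (x - r)))) / e3 ∧ poolres = ((x ^ (2:ℕ) + (1 - x) * d / w) * (1 - x)))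
    (hcase_s : ((1 - (x ^ (2:ℕ) + (1 - x) * d / w)) * x) * e3 < ((x ^ (2:ℕ) + (1 - x) * d / w) * (1 - x) * ((x - r) * (1 - t - r) / (t * (2 - x ^ (2:ℕ) - (1 - x) * r) - x * (x - r)))) → cPres = 0 ∧ poolres = (((x ^ (2:ℕ) + (1 - x) * d / w) * (1 - x)) - ((x ^ (2:ℕ) + (1 - x) * d / w) * (1 - x) * ((x - r) * (1 - t - r) / (t * (2 - x ^ (2:ℕ) - (1 - x) * r) - x * (x - r)))) + ((1 - (x ^ (2:ℕ) + (1 - x) * d / w)) * x) * e3))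
    (hav : (r + d) < 1) (hf : ((x ^ (2:ℕ) + (1 - x) * d / w) * (1 - x) * ((x - r) * (1 - t - r) / (t * (2 - x ^ (2:ℕ) - (1 - x) * r) - x * (x - r)))) ≤ ((1 - (x ^ (2:ℕ) + (1 - x) * d / w)) * x) * e3) (hpre : ((1 - (x ^ (2:ℕ) + (1 - x) * d / w)) * (1 - x) * ((1 + x - r) * (r - x + t * (2 - x)) / (t * (2 - x ^ (2:ℕ) - (1 - x) * r) - x * (x - r)))) ≤ ((x ^ (2:ℕ) + (1 - x) * d / w) * (1 - x) * ((1 + x - r) * (r - x + t * (2 - x)) / (t * (2 - x ^ (2:ℕ) - (1 - x) * r) - x * (x - r)))) * e22 + cPres * e2P)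
    (hk3 : x * (1 + t - w) ≤ (r + d + 2 * t - 2 * w)) :
    ((1 - (x ^ (2:ℕ) + (1 - x) * d / w)) * (1 - x) * ((x - r) * (1 - t - r) / (t * (2 - x ^ (2:ℕ) - (1 - x) * r) - x * (x - r)))) ≤ (((x ^ (2:ℕ) + (1 - x) * d / w) * (1 - x) * ((1 + x - r) * (r - x + t * (2 - x)) / (t * (2 - x ^ (2:ℕ) - (1 - x) * r) - x * (x - r)))) * e22 + cPres * e2P - ((1 - (x ^ (2:ℕ) + (1 - x) * d / w)) * (1 - x) * ((1 + x - r) * (r - x + t * (2 - x)) / (t * (2 - x ^ (2:ℕ) - (1 - x) * r) - x * (x - r))))) * κP + poolres := by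
  rcases lt_or_ge ((r + d + 2 * t)) (1 + t) with h1P | h1Pn
  · exact kB_LMG_H1 x r t d w e2P e22 e3 κP cPres poolres hx0 hx1 hr0 hrx ht hw0 hw1 hd0 hdx hre hre1 hM1 hM2 h2P_N h2P_H h2P_L h22_N h22_H h22_L h3_H h3_L hκ_N hκ_H hκ_L hkA hcase_f hcase_s hav hf hpre hk3 h1P
  · exact kB_LMG_H0 x r t d w e2P e22 e3 κP cPres poolres hx0 hx1 hr0 hrx ht hw0 hw1 hd0 hdx hre hre1 hM1 hM2 h2P_N h2P_H h2P_L h22_N h22_H h22_L h3_H h3_L hκ_N hκ_H hκ_L hkA hcase_f hcase_s hav hf hpre hk3 h1Pn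

end LSCoreLMG

end LawDec

end Quant

end Summit.CriticalPhenomena.PercolationContinuityZ3.Theorems
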